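import Summits.AnomalousDissipation.AnomalousDissipation.Theorems.SawtoothPulseCascadeK1LocalisedCascadeShearStability
import Summits.AnomalousDissipation.AnomalousDissipation.Theorems.SawtoothPulseCascadeK1LocalisedCascadeSawtoothChirp
import Summits.AnomalousDissipation.AnomalousDissipation.Theorems.SawtoothPulseCascadeK1LocalisedCascadeCornerLayer
import Literature.Analysis.FunctionSpaces.TorusCalculus

/-!
# K1loc, line `Spectral` / thin start — helper: THE ROUNDED VS THE EXACT SAWTOOTH HALF-STEP IN `L²` (instantiated stability)

Helper file of the prover lane on the crux `K1LocalisedCascade` (stmt-AnomalousDissipation-19491), route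
`SawtoothPulseCascade` (S-B ↔ S-D glue for the START of the ledger).  Instantiates `…ShearStability` for the actual cascade:
the phase-`j` half-step of the ROUNDED cascade, `x ↦ x − γU_j(x_q)e_p` (`shearMap p q (amp U_j γ)`, `U_j = U_{δ_j}` the
Gaussian-rounded sawtooth of `CascadeParams`), against the half-step of the EXACT sawtooth cascade,
`x ↦ x − (γ·tri(2πN_j x_q)/(2πN_j))e_p` (a continuous, non-smooth circle map — not a `ShearProfile`).
* §1 `norm_sub_single_sub_le_of_partialDeriv` — for `f` smooth on `T^d` with `‖∂_p f‖ ≤ D`: `‖f(y − s·e_p) − f(y)‖ ≤ D‖s‖`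
  (mean value theorem on the lift; the bridge from the sup-gradient bounds of `…IterateGradient` to the Lipschitz hypothesis);
* §2 the exact sawtooth circle map (`periodic_exactProfile`, `continuous_exactCircleMap`), and OFF the corner layer
  `{b : infDist(b, C_{N_j}) < Mδ_j/(πN_j)}` (measure `≤ 4Mδ_j/π`, `volume_real_cornerLayer_le`) the closeness
  `‖γU_j(b) − γ·tri(2πN_j b)/(2πN_j)‖_{ℝ/ℤ} ≤ γe^{−M²/2}/(2N_j)` (`norm_roundedCircleMap_sub_exactCircleMap_le`, from
  `…SawtoothChirp.abs_U_sub_tri_le_of_far` and `…CornerLayer.phase_far_of_le_infDist`);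
* §3 **`sqrt_integral_norm_sq_rounded_sub_exact_le`** — for `v` continuous, `‖v‖ ≤ B`, `L`-Lipschitz along `e_p`, and `w` continuous:
  `‖v∘Φ_δ − w∘Φ_0‖_{L²} ≤ √((Lγe^{−M²/2}/(2N_j))² + (2B)²·4Mδ_j/π) + ‖v − w‖_{L²}` (`M ≥ 1`, `Mδ_j < π/2`).
  Iterated over the `2n` half-steps from the common datum this compares the rounded and the exact inviscid iterates in `L²` at cost
  `≈ Σ_s 2√(4Mδ_{j(s)}/π)` (`B = 1`) plus exponentially small gradient terms — uniformly in the frequency content.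
No definitions; no statement about the crux. [cite: ElgindiLissMattingly2025, §1 (slope ±1 branches)] [cite: Grafakos2014, §3.1]
[problem: turb]
-/

-- `Summit.<Summit>.<Problem>`: single-conjunct summit, the duplicate namespace segment is deliberate.
set_option linter.dupNamespace false

noncomputable section

namespace Summit.AnomalousDissipation.AnomalousDissipation.Theorems.SawtoothPulseCascade.K1Start

open MeasureTheory Set Filter Topology UnitAddTorus Function Metric
open scoped Real
open Literature.Analysis.FunctionSpaces Literature.Analysis.FunctionSpaces.Torus
open Literature.Analysis.FluidPDE Literature.Analysis.FluidPDE.ShearStage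
open Literature.Analysis.FluidPDE.SawtoothCascade Literature.Analysis.FluidPDE.SawtoothCascade.CascadeParams
open Summit.AnomalousDissipation.AnomalousDissipation.Theorems.SawtoothPulseCascade.K1Window
open Summit.AnomalousDissipation.AnomalousDissipation.Theorems.SawtoothPulseCascade.K1Flat

/-! ## §1 Lipschitz along an axis from a bound on the partial derivative -/

section Lipschitz

variable {d : Type*} [Fintype d] [DecidableEq d] {F : Type*} [NormedAddCommGroup F] [NormedSpace ℝ F]

omit [Fintype d] in
/-- `proj (t • e_i) = t·e_i mod 1` coordinatewise: the projection of a multiple of a basis vector is a `Pi.single`. [folklore] -/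
theorem proj_smul_single (i : d) (t : ℝ) :
    proj (t • EuclideanSpace.single i (1 : ℝ)) = (Pi.single i ((t : ℝ) : UnitAddCircle) : UnitAddTorus d) := by
  funext l
  rw [proj_apply]
  by_cases hl : l = i
  · subst hl; simp
  · simp [hl]

/-- **Lipschitz along `e_i` from `|∂_i f| ≤ D`**: for `f` smooth on `T^d` with `‖∂_i f‖ ≤ D` everywhere,
`‖f(y − s·e_i) − f(y)‖ ≤ D·‖s‖` (`‖s‖` the distance on `ℝ/ℤ`; mean value theorem along the lifted segment).
[cite: Grafakos2014, §3.1] -/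
theorem norm_sub_single_sub_le_of_partialDeriv {f : UnitAddTorus d → F} (hf : IsSmooth f) (i : d) {D : ℝ}
    (hD : ∀ x, ‖partialDeriv i f x‖ ≤ D) (y : UnitAddTorus d) (s : UnitAddCircle) :
    ‖f (y - Pi.single i s) - f y‖ ≤ D * ‖s‖ := by
  -- real lift `t` of `s` with `|t| = ‖s‖`
  obtain ⟨t, ht, rfl⟩ : ∃ t : ℝ, t ∈ Ico (-(1 / 2 : ℝ)) (-(1 / 2) + 1) ∧ (t : UnitAddCircle) = s :=
    ⟨(AddCircle.equivIco 1 (-(1 / 2)) s : ℝ), (AddCircle.equivIco 1 (-(1 / 2)) s).2,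
      (AddCircle.equivIco 1 (-(1 / 2))).symm_apply_apply s⟩
  have htabs : |t| ≤ 1 / 2 := abs_le.mpr ⟨ht.1, by linarith [ht.2]⟩
  have hnorm : ‖(t : UnitAddCircle)‖ = |t| := (AddCircle.norm_coe_eq_abs_iff (1 : ℝ) one_ne_zero).mpr (by simpa using htabs)
  rw [hnorm]
  -- the segment `σ ↦ lift f (ỹ − (σ t)•e_i)`, `σ ∈ [0,1]`
  set e : EuclideanSpace ℝ d := EuclideanSpace.single i (1 : ℝ) with he
  set yl : EuclideanSpace ℝ d := repr y with hyl
  set g : ℝ → F := fun σ => lift f (yl - (σ * t) • e) with hg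
  have h1 : IsContDiff 1 f := hf.isContDiff (n := 1) (by exact_mod_cast le_top)
  have hdiff : Differentiable ℝ (lift f) := h1.differentiable one_ne_zero
  have hg0 : g 0 = f y := by
    simp only [hg, zero_mul, zero_smul, sub_zero, lift_apply, hyl, proj_repr]
  have hg1 : g 1 = f (y - Pi.single i ((t : ℝ) : UnitAddCircle)) := by
    simp only [hg, one_mul, lift_apply]
    rw [sub_eq_add_neg, proj_add, hyl, proj_repr, proj_neg, he, proj_smul_single, sub_eq_add_neg]
  -- derivative of the segment map and its bound
  have hderiv : ∀ σ : ℝ, HasDerivAt g (_root_.fderiv ℝ (lift f) (yl - (σ * t) • e) (-(t • e))) σ := by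
    intro σ
    have hγ : HasDerivAt (fun σ : ℝ => yl - (σ * t) • e) (-(t • e)) σ := by
      have h1 : HasDerivAt (fun σ : ℝ => σ * t) t σ := by simpa using (hasDerivAt_id σ).mul_const t
      have h2 := h1.smul_const e
      simpa using h2.const_sub yl
    exact (hdiff _).hasFDerivAt.comp_hasDerivAt σ hγ
  have hbound : ∀ σ : ℝ, ‖_root_.fderiv ℝ (lift f) (yl - (σ * t) • e) (-(t • e))‖ ≤ D * |t| := by
    intro σ
    rw [map_neg, norm_neg, map_smul, norm_smul, Real.norm_eq_abs, mul_comm]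
    refine mul_le_mul_of_nonneg_right ?_ (abs_nonneg t)
    have h := congrFun (lift_lineDeriv h1 e) (yl - (σ * t) • e)
    rw [← h, lift_apply]
    exact hD _
  have hmvt := norm_image_sub_le_of_norm_deriv_le_segment_01' (f := g) (C := D * |t|)
    (fun σ _ => (hderiv σ).hasDerivWithinAt) (fun σ _ => hbound σ)
  rwa [hg1, hg0] at hmvt

end Lipschitz


/-! ## §2 The exact sawtooth shear of phase `j` and its closeness to the rounded one off the corner layer -/

section Cascade

variable (P : CascadeParams)

/-- The exact sawtooth profile of phase `j`, `t ↦ γ·tri(2πN_j t)/(2πN_j)`, is `1`-periodic. [folklore] -/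
theorem periodic_exactProfile (j : ℕ) :
    Function.Periodic (fun t : ℝ => P.γ * (tri (2 * π * P.N j * t) / (2 * π * P.N j))) 1 := by
  intro t
  have h : tri (2 * π * P.N j * (t + 1)) = tri (2 * π * P.N j * t) := by
    rw [show 2 * π * P.N j * (t + 1) = 2 * π * P.N j * t + (P.N j : ℕ) * (2 * π) by ring]
    exact tri_periodic.nat_mul (P.N j) _
  simp only [h]

/-- The exact sawtooth circle map `b ↦ γ·tri(2πN_j b)/(2πN_j) mod 1` is continuous. [folklore] -/
theorem continuous_exactCircleMap (j : ℕ) :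
    Continuous fun b : UnitAddCircle => (((periodic_exactProfile P j).lift b : ℝ) : UnitAddCircle) := by
  have hf : Continuous fun t : ℝ => P.γ * (tri (2 * π * P.N j * t) / (2 * π * P.N j)) :=
    continuous_const.mul ((continuous_tri.comp (continuous_const.mul continuous_id)).div_const _)
  have hlift : Continuous (periodic_exactProfile P j).lift := by
    have h : (periodic_exactProfile P j).lift ∘ (QuotientAddGroup.mk : ℝ → UnitAddCircle) =
        fun t : ℝ => P.γ * (tri (2 * π * P.N j * t) / (2 * π * P.N j)) :=
      funext fun x => (periodic_exactProfile P j).lift_coe x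
    rw [(QuotientAddGroup.isQuotientMap_mk _).continuous_iff]
    change Continuous ((periodic_exactProfile P j).lift ∘ (QuotientAddGroup.mk : ℝ → UnitAddCircle))
    rw [h]
    exact hf
  exact (AddCircle.continuous_mk' (1 : ℝ)).comp hlift

/-- The rounded shear circle map `b ↦ γU_j(b) mod 1` is continuous. [folklore] -/
theorem continuous_roundedCircleMap (hδ₀ : 0 < P.δ₀) (hd : 0 < P.d) (j : ℕ) :
    Continuous fun b : UnitAddCircle =>
      (((amp ⟨P.U j, P.U_periodic j, P.contDiff_U (P.δ_pos hδ₀ hd j)⟩ P.γ).onCircle b : ℝ) : UnitAddCircle) :=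
  (AddCircle.continuous_mk' (1 : ℝ)).comp (ShearProfile.continuous_onCircle _)

/-- **Off the corner layer the two circle maps are exponentially close**: if `infDist(b, C_{N_j}) ≥ Mδ_j/(πN_j)` (`M ≥ 1`,
`Mδ_j < π/2`), then `‖γU_j(b) − γ·tri(2πN_j b)/(2πN_j)‖_{ℝ/ℤ} ≤ γ·e^{−M²/2}/(2N_j)` (`…SawtoothChirp.abs_U_sub_tri_le_of_far` +
`…CornerLayer.phase_far_of_le_infDist`). [cite: ElgindiLissMattingly2025, §1 (slope ±1 branches)] -/
theorem norm_roundedCircleMap_sub_exactCircleMap_le (hδ₀ : 0 < P.δ₀) (hd : 0 < P.d) (hN₀ : 1 ≤ P.N₀) (hρ : 1 ≤ P.ρN)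
    (hγ : 0 ≤ P.γ) {j : ℕ} {M : ℝ} (hM : 1 ≤ M) (hMδ : M * P.δ j < π / 2) {b : UnitAddCircle}
    (hfar : M * P.δ j / (π * P.N j) ≤ infDist b (((Finset.Ico (0 : ℤ) (2 * P.N j)).image
      fun l : ℤ => (((2 * (l : ℝ) + 1) / (4 * P.N j) : ℝ) : UnitAddCircle)) : Set UnitAddCircle)) :
    ‖(((amp ⟨P.U j, P.U_periodic j, P.contDiff_U (P.δ_pos hδ₀ hd j)⟩ P.γ).onCircle b : ℝ) : UnitAddCircle) -
        (((periodic_exactProfile P j).lift b : ℝ) : UnitAddCircle)‖ ≤ P.γ * (Real.exp (-(M ^ 2 / 2)) / (2 * P.N j)) := by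
  obtain ⟨t, rfl⟩ := QuotientAddGroup.mk_surjective b
  have hN := N_pos P hN₀ hρ j
  have hNr : (0 : ℝ) < P.N j := by exact_mod_cast hN
  have hδ : 0 < P.δ j := P.δ_pos hδ₀ hd j
  change ‖(((amp ⟨P.U j, P.U_periodic j, P.contDiff_U (P.δ_pos hδ₀ hd j)⟩ P.γ).onCircle (t : UnitAddCircle) : ℝ) :
      UnitAddCircle) - (((periodic_exactProfile P j).lift (t : UnitAddCircle) : ℝ) : UnitAddCircle)‖ ≤ _
  rw [ShearProfile.onCircle_coe, (periodic_exactProfile P j).lift_coe, amp_apply]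
  refine (norm_coe_sub_coe_le _ _).trans ?_
  change |P.γ * P.U j t - P.γ * (tri (2 * π * P.N j * t) / (2 * π * P.N j))| ≤ _
  rw [← mul_sub, abs_mul, abs_of_nonneg hγ]
  refine mul_le_mul_of_nonneg_left (abs_U_sub_tri_le_of_far P hδ₀ hd hN₀ hρ hM hMδ fun m => ?_) hγ
  have h := phase_far_of_le_infDist hN (t := t) hfar m
  have e : 2 * π * P.N j * (M * P.δ j / (π * P.N j)) = 2 * (M * P.δ j) := by field_simp
  rw [e] at h
  have hMδ0 : 0 < M * P.δ j := by positivity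
  linarith

/-- **The corner layer of width `Mδ_j/(πN_j)` has measure `≤ 4Mδ_j/π`** (real form of `…CornerLayer.volume_layer_le`). [folklore] -/
theorem volume_real_cornerLayer_le (hδ₀ : 0 < P.δ₀) (hd : 0 < P.d) (hN₀ : 1 ≤ P.N₀) (hρ : 1 ≤ P.ρN) (j : ℕ) {M : ℝ}
    (hM : 0 ≤ M) :
    volume.real {b : UnitAddCircle | infDist b (((Finset.Ico (0 : ℤ) (2 * P.N j)).image
      fun l : ℤ => (((2 * (l : ℝ) + 1) / (4 * P.N j) : ℝ) : UnitAddCircle)) : Set UnitAddCircle) < M * P.δ j / (π * P.N j)} ≤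
      4 * M * P.δ j / π := by
  have hN := N_pos P hN₀ hρ j
  have hNr : (0 : ℝ) < P.N j := by exact_mod_cast hN
  have hδ : 0 < P.δ j := P.δ_pos hδ₀ hd j
  have h := volume_layer_le hN (M * P.δ j / (π * P.N j))
  have e : 2 * (P.N j : ℝ) * (2 * (M * P.δ j / (π * P.N j))) = 4 * M * P.δ j / π := by
    field_simp; ring
  rw [e] at h
  have hr : 0 ≤ 4 * M * P.δ j / π := by positivity
  rw [measureReal_def, ← ENNReal.toReal_ofReal hr]
  exact ENNReal.toReal_mono ENNReal.ofReal_ne_top h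

end Cascade

/-! ## §3 The half-step of the rounded cascade against the half-step of the exact sawtooth cascade -/

section HalfStep

variable (P : CascadeParams) {d : Type*} [Fintype d] [DecidableEq d]

/-- **ROUNDED VS EXACT HALF-STEP IN `L²`.**  For the phase-`j` shear along `e_p` driven by `x_q` (`p ≠ q`): if `v` (continuous,
`‖v‖ ≤ B`, `L`-Lipschitz along `e_p` — e.g. `L = sup‖∂_p v‖` by `norm_sub_single_sub_le_of_partialDeriv`) is transported by the
ROUNDED shear `shearMap p q (γU_j)` and `w` (continuous) by the EXACT sawtooth shear `x ↦ x − (γ·tri(2πN_j x_q)/(2πN_j))e_p`, then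
`‖v∘Φ_δ − w∘Φ_0‖_{L²} ≤ √((L·γe^{−M²/2}/(2N_j))² + (2B)²·(4Mδ_j/π)) + ‖v − w‖_{L²}` for every `M ≥ 1` with `Mδ_j < π/2`
(corner layer of phase-width `2Mδ_j`; frequency enters only through `L`, damped by `e^{−M²/2}`).
[cite: ElgindiLissMattingly2025, §1 (slope ±1 branches)] [cite: DEIJ2022, (1.2)–(1.3) (alternating shears)] -/
theorem sqrt_integral_norm_sq_rounded_sub_exact_le (hδ₀ : 0 < P.δ₀) (hd : 0 < P.d) (hN₀ : 1 ≤ P.N₀) (hρ : 1 ≤ P.ρN)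
    (hγ : 0 ≤ P.γ) {j : ℕ} {M : ℝ} (hM : 1 ≤ M) (hMδ : M * P.δ j < π / 2) {p q : d} (hpq : p ≠ q)
    {v w : UnitAddTorus d → ℂ} (hv : Continuous v) (hw : Continuous w) {B L : ℝ} (hB : ∀ y, ‖v y‖ ≤ B) (hL : 0 ≤ L)
    (hLip : ∀ (y : UnitAddTorus d) (s : UnitAddCircle), ‖v (y - Pi.single p s) - v y‖ ≤ L * ‖s‖) :
    Real.sqrt (∫ x : UnitAddTorus d,
        ‖v (shearMap p q (amp ⟨P.U j, P.U_periodic j, P.contDiff_U (P.δ_pos hδ₀ hd j)⟩ P.γ) x) -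
          w (x - Pi.single p ((((periodic_exactProfile P j).lift (x q) : ℝ) : UnitAddCircle)))‖ ^ 2) ≤
      Real.sqrt ((L * (P.γ * (Real.exp (-(M ^ 2 / 2)) / (2 * P.N j)))) ^ 2 + (2 * B) ^ 2 * (4 * M * P.δ j / π)) +
        Real.sqrt (∫ x : UnitAddTorus d, ‖v x - w x‖ ^ 2) := by
  set C : Set UnitAddCircle := (((Finset.Ico (0 : ℤ) (2 * P.N j)).image
    fun l : ℤ => (((2 * (l : ℝ) + 1) / (4 * P.N j) : ℝ) : UnitAddCircle)) : Set UnitAddCircle) with hC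
  set Z : Set UnitAddCircle := {b | infDist b C < M * P.δ j / (π * P.N j)} with hZ
  have hZm : MeasurableSet Z := (isOpen_lt (continuous_infDist_pt C) continuous_const).measurableSet
  have hm : volume.real Z ≤ 4 * M * P.δ j / π := volume_real_cornerLayer_le P hδ₀ hd hN₀ hρ j (by linarith)
  have hoff : ∀ x : UnitAddTorus d, x q ∉ Z →
      ‖v (x - Pi.single p ((((amp ⟨P.U j, P.U_periodic j, P.contDiff_U (P.δ_pos hδ₀ hd j)⟩ P.γ).onCircle (x q) : ℝ) :
          UnitAddCircle))) -
        v (x - Pi.single p ((((periodic_exactProfile P j).lift (x q) : ℝ) : UnitAddCircle)))‖ ≤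
      L * (P.γ * (Real.exp (-(M ^ 2 / 2)) / (2 * P.N j))) := by
    intro x hx
    have hfar : M * P.δ j / (π * P.N j) ≤ infDist (x q) C := not_lt.mp hx
    refine (norm_sub_shear_le_of_lipschitz p q hLip
      (fun b : UnitAddCircle => (((amp ⟨P.U j, P.U_periodic j, P.contDiff_U (P.δ_pos hδ₀ hd j)⟩ P.γ).onCircle b : ℝ) :
        UnitAddCircle))
      (fun b : UnitAddCircle => (((periodic_exactProfile P j).lift b : ℝ) : UnitAddCircle)) x).trans ?_
    exact mul_le_mul_of_nonneg_left (norm_roundedCircleMap_sub_exactCircleMap_le P hδ₀ hd hN₀ hρ hγ hM hMδ hfar) hL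
  have hΦ : ∀ x : UnitAddTorus d, shearMap p q (amp ⟨P.U j, P.U_periodic j, P.contDiff_U (P.δ_pos hδ₀ hd j)⟩ P.γ) x =
      x - Pi.single p ((((amp ⟨P.U j, P.U_periodic j, P.contDiff_U (P.δ_pos hδ₀ hd j)⟩ P.γ).onCircle (x q) : ℝ) :
        UnitAddCircle)) := fun x => shearMap_apply _ _ _ _
  simp_rw [hΦ]
  exact sqrt_integral_norm_sq_sub_shear_le
    (c := fun b : UnitAddCircle => (((amp ⟨P.U j, P.U_periodic j, P.contDiff_U (P.δ_pos hδ₀ hd j)⟩ P.γ).onCircle b : ℝ) :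
      UnitAddCircle))
    (c' := fun b : UnitAddCircle => (((periodic_exactProfile P j).lift b : ℝ) : UnitAddCircle))
    hv hw hB hpq (continuous_roundedCircleMap P hδ₀ hd j) (continuous_exactCircleMap P j) hZm hm hoff

end HalfStep

end Summit.AnomalousDissipation.AnomalousDissipation.Theorems.SawtoothPulseCascade.K1Start
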